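import Literature.MathematicalPhysics.QuantumFieldTheory.Balaban1983to89.B8Prop5JoinSectELocalRDTraceFreeRec
import Literature.MathematicalPhysics.QuantumFieldTheory.Balaban1983to89.B8TraceLogProduct

/-!
# `Balaban1983to89.B8SectETraceFreeRec` — RECORD TWIN of `B8SectETraceFree` ([Balaban1985RegularSpaces] Sect. E (1.113)–(1.121) pp. 95–97 + Proposition 5 (1.107)–(1.109)
# p. 94 at `k` levels with the implicit function `D′` and the gauge parameter `λ′` `τ`-FREE for every continuous tracial `τ` — joint J-SU, `𝔰𝔲(N)`-valuedness of Sect. E's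
# correction and of Proposition 5's output; [Balaban1985Averaging] p. 20 «We consider a Lie subgroup G of a unitary group U(N)», (1.17) p. 78 `𝔤`-valued gauge parameters)
# FOR THE SYMMETRISED CENTRED block averaging (0.4) of [Balaban1987RG1]

statement-level skeleton of published theorems with citation tags; proofs where landed; nothing here is a claim about the Yang–Mills mass gap

T. Bałaban, *Spaces of regular gauge field configurations on a lattice and gauge fixing conditions*, Commun. Math. Phys. **99** (1985) 75–102 `[Balaban1985RegularSpaces]`
("[6]"): p. 76, (1.17) p. 78, Sect. E (1.113)–(1.121) pp. 95–97 («by the contraction mapping theorem there exists exactly one solution of Eq. (1.117)»), Proposition 5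
(1.107)–(1.109) p. 94, (1.92) p. 91, (1.95)–(1.106) pp. 92–94, (1.29) p. 81; T. Bałaban, *Averaging operations for lattice gauge theories*, Commun. Math. Phys. **98** (1985) 17–51
`[Balaban1985Averaging]` ("[3]"): p. 19, p. 20, Prop. 10 p. 50, (213) p. 50; T. Bałaban, *Renormalization group approach to lattice gauge field theories. I*, Commun. Math.
Phys. **109** (1987) 249–301 `[Balaban1987RG1]` ("[I]"): (0.3)–(0.4) pp. 252–253.  STATUS: published, refereed.

CITATION HEADER (lean-in-tree rule).  Cell `pub-ymgap`, «N05-REC» R8 = the `G`∕τ-EDITION OF RECORD (desk `R6-PLAN.md` §6 (B)), file T2 — LEAD PEN dag-n05-e g40.  WHAT IS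
REPRODUCED = ✓ the engine module `B8SectETraceFree` (cell `lit-balaban`, seat `lit-balaban-t2s-1`) VERBATIM under the N05-REC token map of `B8Prop5JoinSectE(LocalRD)Rec`
(`Cnl ∕ Cond179 ∕ InAx ∕ Restr129 ∕ QT ∕ InLambda ↦ CnlZ ∕ Cond179Z ∕ InAxZ ∕ Restr129Z ∕ QTZ ∕ InLambdaZ`, `QprimeIter (zdBlocking d L) (bgT L U₀) ↦ QprimeIter (zdBlockingZ d L)
(bgTZ L U₀)`, tower `B8Ineq130 ↦ B8Ineq130Rec` (CENTRED), regime `(hL : 2 ≤ L) ↦ (hLs : L = 2sL+1) (hs1 : 1 ≤ sL)`, `C0 ↦ C0Z`, the gauge-fixing witness constant `40d·c_B ↦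
20dKZ·c_B` with the record smallness; record inputs `B8SectEKLevelInLambdaRec.eq1117_solution_mem_of_invariant_w`, `B8SectEInLambdaWitnessRec.witness_inv_of_axialZ`,
`B8Prop5JoinSectERec.{exists_Dprime_map, cond179_of_eq114'}`, `B8SectERemainderCovarianceTowerRec.Cnl_negStar_inv_of_axial`, (T1)
`B8Prop5JoinSectELocalRDTraceFreeRec.hFP_kLevel_of179_local_RD_traceFree`; structure-free engine inputs `B8Eq1117KLevel.dom120_of_119_tower`, `B8DprimeKLevelLipschitz.smallness_prod`,
`B8TraceLogProduct.hlog_of_tracial`, `B8Prop5JoinSectE.{cjDiff_le_of_weighted, covLap_smul}` BY NAME; the record's private `ball_sub_119` ∕ `hH1_tower` re-declared privately as in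
`B8Prop5JoinSectERec`): ★ `sectE_traceFree` — the solution `D′(u₁⁻¹, −iλ_s)` of (1.117) is `τ`-free for `τ`-free `λ_s` (closed invariant set of `τ`-free families); ★
`hFP_kLevel_of_sectE_local_RD_traceFree`, ★ `hFP_kLevel_of_sectE_local'_RD_traceFree` — `B8Prop5JoinSectELocalRDRec.hFP_kLevel_of_sectE_local(')_RD` VERBATIM plus the
`τ`-hypotheses (tracial `τ`; `τ(D*A) = 0` on the `Ω_j`; `hHτ`, `hCτ`, `hGτ`, `hRτ`) and the extra conclusion `τ(λ′(x)) = 0`.  THEOREM NAMES = the engine's (namespace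
`…TraceFreeRec`).  Kind «kernel-checked proof», theorems only: no `def`, no `… : Prop` fact, no `instance`, no `notation`, no existing module modified.
`--supports stmt-QuantumFields-20541` (K0⁷-keyed, COUNT-NEUTRAL).

HONEST SCOPE.  Proofs are the originals' with one more invariant closed set; no new analysis; `hCτ` is supplied for the record by (T3) `B8SectERemainderTraceFreeRec.apply_CnlZ_inv_of_axial`
at the socket level (T4); the record crown stays CONDITIONAL on the named Cov facts of `B8Ineq159FlatCovPrintedRec` (O-Cov-1 proved p733782; O-Cov-2 pending); `HThm4Rec`
UNDISCHARGED; N05 ∕ N07 NOT discharged; one finite `𝕋⁴` programme at fixed `ε`, Bałaban AS PRINTED; nothing continuum ∕ ℝ⁴ ∕ OS ∕ mass-gap ∕ Clay.  No `sorry`, no `def`.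
-/

noncomputable section

open NormedSpace Metric Set Filter Topology
open Complex (I)
open scoped BigOperators

namespace Literature.MathematicalPhysics.QuantumFieldTheory.Balaban1983to89.B8SectETraceFreeRec

open MatrixLog (mlog)
open B7Prop1Explicit (e U1 expUnit)
open B7Prop2Explicit (unitaryUnits c2')
open B7Prop2Rec (AvgClosedZ C0Z avgClosedZ_unitaryUnits)
open B7Prop4GeneralLevelsRec (cZ KZ gZ_nonneg)
open B7Prop1Local (InBox pdevOn)
open B7Prop3Flat (expCfg c3)
open B7Eq78Linearization (conjR QprimeIter)
open B7Eq170Flat (cj)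
open B7Prop10General (C6 C4G)
open B7Prop10Flat (one_le_C5 C4'_nonneg C5'_nonneg)
open B7Prop9Flat (C5')
open B7Eq214General (Cgen)
open B8Ineq130Rec (tlo thi)
open B7SectEFLinearisationRec (zdBlockingZ bgTZ InLambdaZ)
open B7Eq92Concrete (mgauge)
open B8Eq119TwistedAxialRec (InAxZ Restr129Z)
open B8Eq178AveragesRec (QnlZ Cond179Z)
open B8Eq1123Concrete (cj_smul_complex)
open B8Eq1123ConcreteRec (CnlZ)
open B8Ineq125Concrete (C2p C2p_nonneg)
open B8Eq1117Concrete (XSpace)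
open B8Eq1117KLevel (dom120_of_119_tower)
open B8DprimeKLevelLipschitz (smallness_prod)
open B8SectEKLevelInLambdaRec (eq1117_solution_mem_of_invariant_w)
open B8SectEInLambdaWitnessRec (witness_inv_of_axialZ)
open B8SectERemainderCovarianceTowerRec (Cnl_negStar_inv_of_axial)
open B8Ineq132 (covDerivFwd covDeriv)
open B8Eq151V2Divergence (covDerivFwd_smul)
open B8Eq138LandauZd (covLap covDivB)
open B8Eq138LandauZdRec (QTZ)
open B8Eq182Proof (gAd)
open B8Eq184Proof (gaugeExp)
open B8Eq188Proof (frakF3)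
open B8LambdaSpaceKLevel (wt lamSubK lamOf norm_lamOf_le norm_cjDiff_lamOf_le)
open B8Prop5ContractionKLevel (Bd2 Mc Kc)
open B8Prop5KLevelLetters (covLap_sub)
open B8Prop5JoinSectE (cjDiff_le_of_weighted covLap_smul)
open B8Prop5JoinSectERec (exists_Dprime_map cond179_of_eq114')
open B8Prop5JoinSectELocalRDTraceFreeRec (hFP_kLevel_of179_local_RD_traceFree)
open B8TraceLogProduct (hlog_of_tracial)

-- `Site` alone could resolve to the torus sites of `Setup.lean`; re-export the `ℤ^d` sites of `B7Prop1Explicit`.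
export B7Prop1Explicit (Site)

variable {d : ℕ} {𝔸 : Type*} [CStarAlgebra 𝔸] [Nontrivial 𝔸]
variable (τ : 𝔸 →L[ℂ] ℂ)

omit [Nontrivial 𝔸] in
/-- The record's gauge-fixing witness constant `20dKZ·c` is non-negative (`KZ = 2(1 + 2g_Z) ≥ 0`). [folklore] -/
private theorem alpha3Z_nonneg (L : ℕ) {c : ℝ} (hc : 0 ≤ c) : 0 ≤ 20 * (d : ℝ) * KZ d L * c := by
  have hK : 0 ≤ KZ d L := by unfold KZ; have := gZ_nonneg d L; positivity
  positivity

omit [Nontrivial 𝔸] in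
/-- `‖(−i)·a‖ = ‖a‖`. [folklore] -/
private theorem norm_negI_smul (a : 𝔸) : ‖(-I) • a‖ = ‖a‖ := by
  rw [norm_smul, norm_neg, Complex.norm_I, one_mul]

omit [Nontrivial 𝔸] in
/-- `(−i)·a` is Hermitian when `a* = −a`. [folklore] -/
private theorem isSelfAdjoint_negI_smul_of_skew {a : 𝔸} (ha : star a = -a) : IsSelfAdjoint ((-I) • a) := by
  have h1 : star ((-I) • a) = I • star a := by rw [star_smul, star_neg, Complex.star_def, Complex.conj_I, neg_neg]
  rw [IsSelfAdjoint, h1, ha, smul_neg, ← neg_smul]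

/-! ## §1 Sect. E's `D′(u₁⁻¹, −iλ_s)` is `τ`-free -/

section SectE

variable {L sL k : ℕ} {η : ℝ} {Λs : ℕ → Set (Site d)} {Eb : ℕ → Set (Site d × Fin d)} {U₀ : Site d → Fin d → 𝔸ˣ}
  {B : Site d → Fin d → 𝔸} {u₁ : Site d → 𝔸ˣ} {α₀ αP α₄ c B₀' : ℝ}

omit [Nontrivial 𝔸] in
/-- **(1.102)-ball ⇒ (1.119) on the towers, for `λ_E := −iλ`** (the (a″) convention of the join, `pub-ymgap-dag-n05-a` RULING INBOX l.11309:
Sect. E is run on the inverse pair `(e^{−iλ}, u₁⁻¹)` at the same background `U₀`): if `‖s‖ ≤ ¼α₄` and every bond of the tower `Bʲ(y)`,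
`y ∈ Λ_j`, is a bond of `Eb j`, then `‖(−iλ_s)(x)‖ < ½α₄` on the tower and `‖R(U₀(b))(−iλ_s)(b₊) − (−iλ_s)(b₋)‖ < ½α₄·L^{−j}` on its bonds.
[cite: Balaban1985RegularSpaces, (1.102) p.93, (1.119) p.96, (1.113) p.95] -/
private theorem ball_sub_119 (hL : 1 ≤ L) (hη : 0 < η) {α₄ : ℝ} (hα₄ : 0 < α₄)
    (hEbT : ∀ j, j ≤ k → ∀ y ∈ Λs j, ∀ (x : Site d) (κ : Fin d), InBox (tlo L y j) (thi L y j) x →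
      InBox (tlo L y j) (thi L y j) (x + e κ) → (x, κ) ∈ Eb j)
    (s : lamSubK η U₀ L k Eb) (hs : ‖s‖ ≤ α₄ / 4) :
    (∀ j, j ≤ k → ∀ y ∈ Λs j, ∀ x : Site d, InBox (tlo L y j) (thi L y j) x → ‖((-I) • lamOf s) x‖ < α₄ / 2) ∧
      ∀ j, j ≤ k → ∀ y ∈ Λs j, ∀ (x : Site d) (κ : Fin d), InBox (tlo L y j) (thi L y j) x →
        InBox (tlo L y j) (thi L y j) (x + e κ) →
          ‖cj (U₀ x κ) (((-I) • lamOf s) (x + e κ)) - ((-I) • lamOf s) x‖ < α₄ / 2 * ((L : ℝ) ^ j)⁻¹ := by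
  refine ⟨fun j _ y _ x _ => ?_, fun j hj y hy x κ hx hxe => ?_⟩
  · rw [Pi.smul_apply, norm_negI_smul]
    exact ((norm_lamOf_le s x).trans hs).trans_lt (by linarith)
  · have hLj : (0 : ℝ) < ((L : ℝ) ^ j)⁻¹ := by
      have : (0 : ℝ) < L := by exact_mod_cast hL
      positivity
    rw [Pi.smul_apply, Pi.smul_apply, cj_smul_complex, ← smul_sub, norm_negI_smul]
    calc ‖cj (U₀ x κ) (lamOf s (x + e κ)) - lamOf s x‖ ≤ ‖s‖ * ((L : ℝ) ^ j)⁻¹ :=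
          norm_cjDiff_lamOf_le hL hη s hj (hEbT j hj y hy x κ hx hxe)
      _ ≤ α₄ / 4 * ((L : ℝ) ^ j)⁻¹ := mul_le_mul_of_nonneg_right hs hLj.le
      _ < α₄ / 2 * ((L : ℝ) ^ j)⁻¹ := mul_lt_mul_of_pos_right (by linarith) hLj

omit [Nontrivial 𝔸] in
/-- The tower form of the `H′`-modulus (n05-b's `hH1`) from its `Eb`-weighted form. [cite: Balaban1985RegularSpaces, (1.92) p.91, (1.119) p.96] -/
private theorem hH1_tower (hL1 : 1 ≤ L) (hη : 0 < η) (H' : XSpace d k 𝔸 →ₗ[ℂ] (Site d → 𝔸))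
    (hEbT : ∀ j, j ≤ k → ∀ y ∈ Λs j, ∀ (x : Site d) (κ : Fin d), InBox (tlo L y j) (thi L y j) x →
      InBox (tlo L y j) (thi L y j) (x + e κ) → (x, κ) ∈ Eb j)
    (hH1 : ∀ j, j ≤ k → ∀ (X : XSpace d k 𝔸), ∀ p ∈ Eb j, wt L η j * ‖covDerivFwd η U₀ p.2 (H' X) p.1‖ ≤ B₀' * ‖X‖) :
    ∀ j, j ≤ k → ∀ y ∈ Λs j, ∀ (X : XSpace d k 𝔸) (x : Site d) (κ : Fin d), InBox (tlo L y j) (thi L y j) x →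
      InBox (tlo L y j) (thi L y j) (x + e κ) → ‖cj (U₀ x κ) (H' X (x + e κ)) - H' X x‖ ≤ B₀' * ‖X‖ * ((L : ℝ) ^ j)⁻¹ :=
  fun j hj y hy X x κ hx hxe => cjDiff_le_of_weighted hL1 hη (hH1 j hj X (x, κ) (hEbT j hj y hy x κ hx hxe))


/-- **`D′(u₁⁻¹, −iλ_s)` IS `τ`-FREE FOR `τ`-FREE `λ_s`** (joint J-SU; print p. 76: for `G = SU(N)` the configurations of Sect. E are `𝔤 = 𝔰𝔲(N)`-valued):
for a continuous linear functional `τ`, if [4]'s `H′` maps `τ`-free families to `τ`-free configurations (`hHτ`) and [3]'s remainder `C′_j(u₁⁻¹, μ)(y)` is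
`τ`-free for `τ`-free `μ` on the (1.120)-set of the tower (`hCτ`), then any `X` in the ball solving (1.117) for `−iλ_s` on `𝔅_k` and vanishing off `𝔅_k`
has `τ(X(j, y)) = 0`: the `τ`-free families form a closed set containing `0`, invariant under the masked (1.118), and the contraction's iterates from `0`
stay in it (`B8SectEKLevelInLambda.eq1117_solution_mem_of_invariant_w`, the `u₁⁻¹ ∈ Λ`-witness by `B8SectEInLambdaWitness.witness_inv_of_axial`).
The reality sibling is `B8Prop5JoinSectE.sectE_real`.
[cite: Balaban1985RegularSpaces, (1.117)–(1.121) pp.96–97, p.97 (exactly one solution), p.76, (1.17) p.78; Balaban1985Averaging, Prop. 10 p.50, (213) p.50] -/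
theorem sectE_traceFree (hLs : L = 2 * sL + 1) (hs1 : 1 ≤ sL) (hη : 0 < η) (hU₀ : ∀ x κ, U₀ x κ ∈ unitaryUnits 𝔸) (H' : XSpace d k 𝔸 →ₗ[ℂ] (Site d → 𝔸))
    (hα : 0 < α₀) (hα3 : C0Z d * α₀ ≤ 1 / 3) (hα4 : 4 * α₀ ≤ c2' d L) (hc : 0 ≤ c) (hα₄ : 0 < α₄) (hB : 0 < B₀')
    (h33 : ∀ j, j ≤ k → ∀ y ∈ Λs j, pdevOn (tlo L y j) (thi L y j) U₀ < α₀ * (((L : ℝ) ^ j)⁻¹) ^ 2)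
    (h69 : ∀ j, j ≤ k → ∀ y ∈ Λs j, ∀ (x : Site d) (κ : Fin d), InBox (tlo L y j) (thi L y j) x →
      InBox (tlo L y j) (thi L y j) (x + e κ) → ‖B x κ‖ ≤ c * ((L : ℝ) ^ j)⁻¹)
    (hd : 1 ≤ d) (hαP : 0 < αP) (hαP3 : C0Z d * αP ≤ 1 / 3) (hαP2 : 2 * αP ≤ c2' d L)
    (hBu : ∀ (x : Site d) (κ : Fin d), expCfg B x κ ∈ unitaryUnits 𝔸)
    (hP : ∀ j, j ≤ k → ∀ y ∈ Λs j, pdevOn (tlo L y j) (thi L y j) (expCfg B * U₀) < αP * (((L : ℝ) ^ j)⁻¹) ^ 2)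
    (hAx : InAxZ L k Λs U₀ (mgauge U₀ u₁ (expCfg B) * U₀)) (h129 : Restr129Z L k Λs U₀ u₁)
    (hEbT : ∀ j, j ≤ k → ∀ y ∈ Λs j, ∀ (x : Site d) (κ : Fin d), InBox (tlo L y j) (thi L y j) x →
      InBox (tlo L y j) (thi L y j) (x + e κ) → (x, κ) ∈ Eb j)
    (hH0 : ∀ (X : XSpace d k 𝔸) (x : Site d), ‖H' X x‖ ≤ B₀' * ‖X‖)
    (hH1 : ∀ j, j ≤ k → ∀ (X : XSpace d k 𝔸), ∀ p ∈ Eb j, wt L η j * ‖covDerivFwd η U₀ p.2 (H' X) p.1‖ ≤ B₀' * ‖X‖)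
    (hHτ : ∀ X : XSpace d k 𝔸, (∀ p, τ (X p) = 0) → ∀ x, τ (H' X x) = 0)
    (hCτ : ∀ j, j ≤ k → ∀ y ∈ Λs j, ∀ μ : Site d → 𝔸, (∀ x, τ (μ x) = 0) →
      (∀ x : Site d, InBox (tlo L y j) (thi L y j) x → ‖μ x‖ < α₄) →
      (∀ (x : Site d) (κ : Fin d), InBox (tlo L y j) (thi L y j) x → InBox (tlo L y j) (thi L y j) (x + e κ) →
        ‖cj (U₀ x κ) (μ (x + e κ)) - μ x‖ < α₄ * ((L : ℝ) ^ j)⁻¹) →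
      τ (CnlZ L U₀ u₁⁻¹ j μ y) = 0)
    (hsmall : Real.exp (4 * cZ d * α₀) * (1 + 2 * (131072 * ((d : ℝ) + 1) ^ 2) * (KZ d L) ^ 2 * c) ≤ 2)
    (hc₃ : KZ d L * c ≤ c3 d L) (hsc : 1024 * (d : ℝ) * KZ d L * c ≤ 1) (hα₃' : 20 * d * KZ d L * c ≤ 1 / 200)
    (hs₁ : 200 * C6 d * (2 * α₄) ≤ 1) (hs₂ : 12000 * ((d : ℝ) + 1) * L * (2 * α₄) ≤ 1)
    (hs₃ : C4G d L * (α₀ + 20 * d * KZ d L * c + 4 * (2 * α₄)) ≤ 1)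
    (hs₄ : 1024 * ((d : ℝ) + 1) * ((d : ℝ) + 4) * L ^ 2 * α₀ ≤ 1) (hs₅ : 32 * ((d : ℝ) + 1) ^ 2 * C6 d * L ^ 2 * α₀ ≤ 1)
    (hs₆ : 16 * d * C5' d * C6 d * (L : ℝ) ^ 2 * α₀ ≤ 1) (hs₇ : 8 * d * C6 d * L * α₀ ≤ 1)
    (hsm : 20 * d * KZ d L * c + α₄ ≤ 1 / (4 * B₀' * (2 * C2p d)))
    (s : lamSubK η U₀ L k Eb) (hs : ‖s‖ ≤ α₄ / 4) (hsτ : ∀ x, τ (lamOf s x) = 0)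
    {X : XSpace d k 𝔸} (hXρ : ‖X‖ ≤ α₄ / (2 * B₀'))
    (hXzero : ∀ (j : ℕ) (hj : j ≤ k) (y : Site d), y ∉ Λs j → X (⟨j, Nat.lt_succ_of_le hj⟩, y) = 0)
    (hXfix : ∀ (j : ℕ) (hj : j ≤ k) (y : Site d), y ∈ Λs j →
      CnlZ L U₀ u₁⁻¹ j ((-I) • lamOf s - H' X) y = X (⟨j, Nat.lt_succ_of_le hj⟩, y)) :
    ∀ p, τ (X p) = 0 := by
  have hL1 : 1 ≤ L := by omega
  obtain ⟨h119b, h119a⟩ := ball_sub_119 (Λs := Λs) hL1 hη hα₄ hEbT s hs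
  have hH1t := hH1_tower hL1 hη H' hEbT hH1
  have hwit := witness_inv_of_axialZ hLs hs1 hd hU₀ Λs hα hα3 hα4 hc hsmall hc₃ hsc hαP hαP3 hαP2 hL1 hBu h33 h69 hP hAx h129
  set S : Set (XSpace d k 𝔸) := {X | ∀ p, τ (X p) = 0} with hS_def
  have hS : IsClosed S := by
    have hS' : S = ⋂ p : Fin (k + 1) × Site d, {X : XSpace d k 𝔸 | τ (X p) = 0} := by
      ext X; simp only [hS_def, Set.mem_setOf_eq, Set.mem_iInter]
    rw [hS']
    exact isClosed_iInter fun p =>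
      isClosed_eq (τ.continuous.comp (continuous_eval_const p)) continuous_const
  have h0 : (0 : XSpace d k 𝔸) ∈ S := fun p => by simp
  have hinv : ∀ X ∈ S, ‖X‖ ≤ α₄ / (2 * B₀') → ∀ Y : XSpace d k 𝔸,
      (∀ p : Fin (k + 1) × Site d, (p.2 ∈ Λs p.1 → Y p = CnlZ L U₀ u₁⁻¹ p.1 ((-I) • lamOf s - H' X) p.2) ∧ (p.2 ∉ Λs p.1 → Y p = 0)) →
      Y ∈ S := by
    intro X hX hXρ' Y hY p
    obtain ⟨h1, h2⟩ := hY p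
    by_cases hp : p.2 ∈ Λs p.1
    · rw [h1 hp]
      have hj : (p.1 : ℕ) ≤ k := Nat.le_of_lt_succ p.1.isLt
      obtain ⟨ha, hb⟩ := dom120_of_119_tower H' hB (by positivity) hH0 (hH1t p.1 hj p.2 hp) (h119a p.1 hj p.2 hp) (h119b p.1 hj p.2 hp) hXρ'
      refine hCτ p.1 hj p.2 hp _ (fun x => ?_) hb ha
      rw [Pi.sub_apply, Pi.smul_apply, map_sub, map_smul, hsτ x, hHτ X hX x, smul_zero, sub_zero]
    · rw [h2 hp, map_zero]
  exact eq1117_solution_mem_of_invariant_w (Λ := Λs) (lam := (-I) • lamOf s) (u₁ := u₁⁻¹) hLs hs1 hd hL1 (avgClosedZ_unitaryUnits d L) hU₀ hα hα3 hα4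
    (alpha3Z_nonneg L hc) hα₄ hB h33 hwit h119b h119a hH0 hH1t hα₃' hs₁ hs₂ hs₃ hs₄ hs₅ hs₆ hs₇ hsm S hS h0 hinv hXρ hXzero hXfix


end SectE

/-! ## §2 JOIN-C (local inversion route, inverse laws on print's domains) with `λ′` `τ`-free -/

section JoinLocal

variable {L sL k : ℕ} {η : ℝ} {Ω Λs : ℕ → Set (Site d)} {Eb : ℕ → Set (Site d × Fin d)} {U₀ : Site d → Fin d → 𝔸ˣ}
  {A : Site d → Fin d → 𝔸} {u₁ : Site d → 𝔸ˣ}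

/-- **JOIN-C, LOCAL INVERSION ROUTE, INVERSE LAWS ON PRINT'S DOMAINS — WITH THE GAUGE PARAMETER `τ`-FREE** (joint J-SU):
`B8Prop5JoinSectELocalRD.hFP_kLevel_of_sectE_local_RD` VERBATIM (hypotheses and conclusion), plus: a continuous tracial functional `τ` (`τ(xy) = τ(yx)`),
`τ(D*A) = 0` on the `Ω_j`, `τ`-compatibility of [4]'s letters `H′` (`hHτ`), `G′` (`hGτ`), `R` (`hRτ`) and of [3]'s remainder `C′_j(u₁⁻¹, ·)` on the
(1.120)-set of each tower (`hCτ` — for `M_N(ℂ)`, `τ = tr`, `G = SU(N)` this is «the averages of `SU(N)`-valued fields are `SU(N)`-valued», [3] p. 19);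
CONCLUSION: JOIN-B's, and **`τ(λ′(x)) = 0` at every site** — so `v = u₁e^{iλ′}` has `det v = det u₁` pointwise (print p. 76: everything `𝔤`-valued for
`G = SU(N)`).  Proof = the original's, with `H_c λ := −i·H′D′(u₁⁻¹, −iλ)` now also `τ`-free (`sectE_traceFree` + `hHτ`) and the storey below replaced by
`B8Prop5JoinSectELocalRDTraceFree.hFP_kLevel_of179_local_RD_traceFree` ((T2) by `B8TraceLogProduct.hlog_of_tracial`).
[cite: Balaban1985RegularSpaces, Prop. 5 (1.107)–(1.109) p.94, (1.113)–(1.121) pp.95–97, p.76, (1.17) p.78; Balaban1985Averaging, p.19, Prop. 10 p.50, (213) p.50] -/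
theorem hFP_kLevel_of_sectE_local_RD_traceFree (hτ : ∀ x y : 𝔸, τ (x * y) = τ (y * x)) (hLs : L = 2 * sL + 1) (hs1 : 1 ≤ sL) (hη : 0 < η) (hU₀ : ∀ x κ, U₀ x κ ∈ unitaryUnits 𝔸)
    (hEbΩ : ∀ j, j ≤ k → ∀ x ∈ Ω j, ∀ μ : Fin d, (x, μ) ∈ Eb j ∧ (x - e μ, μ) ∈ Eb j)
    (hEbT : ∀ j, j ≤ k → ∀ y ∈ Λs j, ∀ (x : Site d) (κ : Fin d), InBox (tlo L y j) (thi L y j) x →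
      InBox (tlo L y j) (thi L y j) (x + e κ) → (x, κ) ∈ Eb j)
    -- letters of [4]
    (g Δ : (Site d → 𝔸) →ₗ[ℂ] (Site d → 𝔸)) (q : (Site d → 𝔸) →ₗ[ℂ] (ℕ → Site d → 𝔸)) (qs : (ℕ → Site d → 𝔸) →ₗ[ℂ] (Site d → 𝔸))
    (Aw c : (ℕ → Site d → 𝔸) →ₗ[ℂ] (ℕ → Site d → 𝔸))
    (g_rightΩ : ∀ x, ∀ y ∈ Ω 0, (Δ (g x) + qs (Aw (q (g x)))) y = x y)
    (c_range : ∀ f, q (g (g (qs (c (q f))))) = q f)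
    (hΔ : ∀ (f : Site d → 𝔸), ∀ x ∈ Ω 0, Δ f x = covLap η U₀ ((Ω 0).indicator f) x)
    (hqs : ∀ (μ : ℕ → Site d → 𝔸), ∀ x ∈ Ω 0, qs μ x = QTZ L k Λs U₀ μ x)
    (hq : ∀ (f : Site d → 𝔸) (j : ℕ), j ≤ k → ∀ y ∈ Λs j, q f j y = QprimeIter (zdBlockingZ d L) (bgTZ L U₀) j f y)
    -- the letter H′ of [4] ((1.92)) and the Sect. E / local-inversion regime (tower-local, everything AT u₁)
    (H' : XSpace d k 𝔸 →ₗ[ℂ] (Site d → 𝔸)) {B : Site d → Fin d → 𝔸} {α₀ αP α₄ cB B₀' B₂' : ℝ}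
    (hα : 0 < α₀) (hα3 : C0Z d * α₀ ≤ 1 / 3) (hα4 : 4 * α₀ ≤ c2' d L) (hcB : 0 ≤ cB) (hα₄ : 0 < α₄) (hB : 0 < B₀') (hB₂ : 0 ≤ B₂')
    (h33 : ∀ j, j ≤ k → ∀ y ∈ Λs j, pdevOn (tlo L y j) (thi L y j) U₀ < α₀ * (((L : ℝ) ^ j)⁻¹) ^ 2)
    (h69 : ∀ j, j ≤ k → ∀ y ∈ Λs j, ∀ (x : Site d) (κ : Fin d), InBox (tlo L y j) (thi L y j) x →
      InBox (tlo L y j) (thi L y j) (x + e κ) → ‖B x κ‖ ≤ cB * ((L : ℝ) ^ j)⁻¹)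
    (hd : 1 ≤ d) (hαP : 0 < αP) (hαP3 : C0Z d * αP ≤ 1 / 3) (hαP2 : 2 * αP ≤ c2' d L)
    (hBu : ∀ (x : Site d) (κ : Fin d), expCfg B x κ ∈ unitaryUnits 𝔸)
    (hP : ∀ j, j ≤ k → ∀ y ∈ Λs j, pdevOn (tlo L y j) (thi L y j) (expCfg B * U₀) < αP * (((L : ℝ) ^ j)⁻¹) ^ 2)
    (hAx : InAxZ L k Λs U₀ (mgauge U₀ u₁ (expCfg B) * U₀)) (h129 : Restr129Z L k Λs U₀ u₁)
    (hH0 : ∀ (X : XSpace d k 𝔸) (x : Site d), ‖H' X x‖ ≤ B₀' * ‖X‖)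
    (hH1 : ∀ j, j ≤ k → ∀ (X : XSpace d k 𝔸), ∀ p ∈ Eb j, wt L η j * ‖covDerivFwd η U₀ p.2 (H' X) p.1‖ ≤ B₀' * ‖X‖)
    (hH2 : ∀ X : XSpace d k 𝔸, Bd2 L η k Ω (covLap η U₀ (H' X)) (B₂' * ‖X‖))
    (hHsupp : ∀ (X : XSpace d k 𝔸) (x : Site d), x ∉ Ω 0 → H' X x = 0)
    (hHequiv : ∀ X Y : XSpace d k 𝔸, (∀ p, Y p = -star (X p)) → ∀ x, H' Y x = -star (H' X x))
    (hQH : ∀ (Y : XSpace d k 𝔸) (j : ℕ) (hj : j ≤ k) (y : Site d), y ∈ Λs j →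
      QprimeIter (zdBlockingZ d L) (bgTZ L U₀) j (H' Y) y = Y (⟨j, Nat.lt_succ_of_le hj⟩, y))
    (hCequiv : ∀ j, j ≤ k → ∀ y ∈ Λs j, ∀ μ : Site d → 𝔸,
      (∀ x : Site d, InBox (tlo L y j) (thi L y j) x → ‖μ x‖ < α₄) →
      (∀ (x : Site d) (κ : Fin d), InBox (tlo L y j) (thi L y j) x → InBox (tlo L y j) (thi L y j) (x + e κ) →
        ‖cj (U₀ x κ) (μ (x + e κ)) - μ x‖ < α₄ * ((L : ℝ) ^ j)⁻¹) →
      CnlZ L U₀ u₁⁻¹ j (fun x => -star (μ x)) y = -star (CnlZ L U₀ u₁⁻¹ j μ y))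
    (hsmall : Real.exp (4 * cZ d * α₀) * (1 + 2 * (131072 * ((d : ℝ) + 1) ^ 2) * (KZ d L) ^ 2 * cB) ≤ 2)
    (hc₃ : KZ d L * cB ≤ c3 d L) (hsc : 1024 * (d : ℝ) * KZ d L * cB ≤ 1) (hα₃' : 20 * d * KZ d L * cB ≤ 1 / 200)
    (hs₁ : 200 * C6 d * (2 * α₄) ≤ 1) (hs₂ : 12000 * ((d : ℝ) + 1) * L * (2 * α₄) ≤ 1)
    (hs₃ : C4G d L * (α₀ + 20 * d * KZ d L * cB + 4 * (2 * α₄)) ≤ 1)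
    (hs₄ : 1024 * ((d : ℝ) + 1) * ((d : ℝ) + 4) * L ^ 2 * α₀ ≤ 1) (hs₅ : 32 * ((d : ℝ) + 1) ^ 2 * C6 d * L ^ 2 * α₀ ≤ 1)
    (hs₆ : 16 * d * C5' d * C6 d * (L : ℝ) ^ 2 * α₀ ≤ 1) (hs₇ : 8 * d * C6 d * L * α₀ ≤ 1)
    (hsm : 20 * d * KZ d L * cB + α₄ ≤ 1 / (4 * B₀' * (2 * C2p d))) (hprod : 2 * C6 d * (20 * d * KZ d L * cB + 4 * (2 * α₄)) < 1 / 2)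
    -- the Sect. E sizes of H_c (named, so that the windows below read)
    {hE hE₂ lE lE₂ : ℝ} (hE_def : hE = B₀' * (C2p d * (20 * d * KZ d L * cB + α₄) * α₄)) (hE₂_def : hE₂ = B₂' * (C2p d * (20 * d * KZ d L * cB + α₄) * α₄))
    (lE_def : lE = B₀' * (4 * C2p d * (20 * d * KZ d L * cB + 2 * α₄))) (lE₂_def : lE₂ = B₂' * (4 * C2p d * (20 * d * KZ d L * cB + 2 * α₄)))
    -- JOIN-B's letters G′, R, the datum, and its windows at these sizes
    {BG BR cA cDA : ℝ} (hBG : 0 ≤ BG) (hBR : 0 ≤ BR) (hcA : 0 ≤ cA) (hcA' : cA ≤ 1 / 13) (hcDA : 0 ≤ cDA)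
    (ha₁' : α₄ / 4 + hE ≤ 1 / 24) (hb₁' : α₄ / 4 + hE ≤ 1 / 140) (hθ : 10 * (α₄ / 4 + hE) * BR ≤ 1 / 2)
    (hG : ∀ (f : Site d → 𝔸) (m : ℝ), 0 ≤ m → Bd2 L η k Ω f m →
      (∀ x, ‖g f x‖ ≤ BG * m) ∧ ∀ j, j ≤ k → ∀ p ∈ Eb j, wt L η j * ‖covDerivFwd η U₀ p.2 (g f) p.1‖ ≤ BG * m)
    (hGsupp : ∀ (f : Site d → 𝔸) (x : Site d), x ∉ Ω 0 → g f x = 0)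
    (hGreal : ∀ f : Site d → 𝔸, (∀ j, j ≤ k → ∀ x ∈ Ω j, IsSelfAdjoint (f x)) → ∀ x, IsSelfAdjoint (g f x))
    (hRbd : ∀ (f : Site d → 𝔸) (m : ℝ), 0 ≤ m → Bd2 L η k Ω f m → Bd2 L η k Ω (f - g (qs (c (q (g f))))) (BR * m))
    (hRreal : ∀ f : Site d → 𝔸, (∀ j, j ≤ k → ∀ x ∈ Ω j, IsSelfAdjoint (f x)) →
      ∀ j, j ≤ k → ∀ x ∈ Ω j, IsSelfAdjoint ((f - g (qs (c (q (g f))))) x))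
    (hDA : Bd2 L η k Ω (fun y => covDivB η U₀ A y) cDA) (hDAsa : ∀ j, j ≤ k → ∀ x ∈ Ω j, IsSelfAdjoint (covDivB η U₀ A x))
    (hA : ∀ j, j ≤ k → ∀ x ∈ Ω j, ∀ μ : Fin d,
      wt L η j * ‖A x μ‖ ≤ cA ∧ wt L η j * ‖conjR (U₀ (x - e μ) μ)⁻¹ (A (x - e μ) μ)‖ ≤ cA)
    (hAsa : ∀ x μ, IsSelfAdjoint (A x μ))
    (h103 : BG * Mc d BR (α₄ / 4 + hE) cA hE₂ cDA ≤ α₄ / 4)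
    (h106 : BG * Kc d BR (α₄ / 4 + hE) cA hE₂ cDA lE₂ (1 + lE) (1 + lE) ≤ 1 / 2)
    -- `τ`-freeness of the datum and `τ`-compatibility of the letters (joint J-SU)
    (hDAτ : ∀ j, j ≤ k → ∀ x ∈ Ω j, τ (covDivB η U₀ A x) = 0)
    (hHτ : ∀ X : XSpace d k 𝔸, (∀ p, τ (X p) = 0) → ∀ x, τ (H' X x) = 0)
    (hCτ : ∀ j, j ≤ k → ∀ y ∈ Λs j, ∀ μ : Site d → 𝔸, (∀ x, τ (μ x) = 0) →
      (∀ x : Site d, InBox (tlo L y j) (thi L y j) x → ‖μ x‖ < α₄) →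
      (∀ (x : Site d) (κ : Fin d), InBox (tlo L y j) (thi L y j) x → InBox (tlo L y j) (thi L y j) (x + e κ) →
        ‖cj (U₀ x κ) (μ (x + e κ)) - μ x‖ < α₄ * ((L : ℝ) ^ j)⁻¹) →
      τ (CnlZ L U₀ u₁⁻¹ j μ y) = 0)
    (hRτ : ∀ f : Site d → 𝔸, (∀ j, j ≤ k → ∀ x ∈ Ω j, τ (f x) = 0) →
      ∀ j, j ≤ k → ∀ x ∈ Ω j, τ ((f - g (qs (c (q (g f))))) x) = 0)
    (hGτ : ∀ f : Site d → 𝔸, (∀ j, j ≤ k → ∀ x ∈ Ω j, τ (f x) = 0) → ∀ x, τ (g f x) = 0) :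
    ∃ lam : Site d → 𝔸, (∀ x, IsSelfAdjoint (lam x)) ∧ (∀ x, x ∉ Ω 0 → lam x = 0) ∧ (∀ x, τ (lam x) = 0) ∧
      (∀ j, j ≤ k → ∀ p ∈ Eb j, ‖lam p.1‖ ≤ α₄ ∧ wt L η j * ‖covDerivFwd η U₀ p.2 lam p.1‖ ≤ α₄) ∧
      (∃ μ : ℕ → Site d → 𝔸, ∀ x ∈ Ω 0,
        covLap η U₀ ((Ω 0).indicator fun y => covDivB η U₀ A y + covLap η U₀ lam y +
          ((conjR (gaugeExp lam y)⁻¹ (covDivB η U₀ A y) - covDivB η U₀ A y) +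
            (gAd (covLap η U₀ lam y) (lam y) - covLap η U₀ lam y) + ∑ μ, frakF3 η U₀ lam A y μ)) x = QTZ L k Λs U₀ μ x) ∧
      Restr129Z L k Λs U₀ (u₁ * gaugeExp lam) := by
  have hL1 : 1 ≤ L := by omega
  have hC2 : 0 ≤ C2p d := C2p_nonneg d
  have hC2pos : 0 < C2p d := by
    have hC6 : (2 : ℝ) ≤ C6 d := by unfold C6; linarith [one_le_C5 (d := d)]
    unfold C2p Cgen; positivity
  have hα₃ : (0 : ℝ) ≤ 20 * d * KZ d L * cB := alpha3Z_nonneg L hcB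
  have hhE : 0 ≤ hE := by rw [hE_def]; positivity
  have hhE₂ : 0 ≤ hE₂ := by rw [hE₂_def]; positivity
  have hlE : 0 ≤ lE := by rw [lE_def]; positivity
  have hlE₂ : 0 ≤ lE₂ := by rw [lE₂_def]; positivity
  have hb₁ : 0 < α₄ / 4 + hE := add_pos_of_pos_of_nonneg (by positivity) hhE
  -- `h₀ ≤ ¾α₄` from print's smallness in product form
  have hh₀' : hE ≤ 3 * α₄ / 4 := by
    have h8 := (B8SectEKLevelInLambda.smallness_prod_w (d := d) hα₃ hB hC2pos hsm).1
    have e1 : hE = (C2p d * (20 * d * KZ d L * cB + α₄) * B₀') * α₄ := by rw [hE_def]; ring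
    rw [e1]
    calc C2p d * (20 * d * KZ d L * cB + α₄) * B₀' * α₄ ≤ 1 / 8 * α₄ := mul_le_mul_of_nonneg_right h8 hα₄.le
      _ ≤ 3 * α₄ / 4 := by linarith only [hα₄]
  -- THE solution map D′(u₁⁻¹, −i·) on the ¼α₄-ball (chosen once; Lipschitz; real on Hermitian λ)
  obtain ⟨Dp, hDp, hDpL, hDpR⟩ := exists_Dprime_map hLs hs1 hη hU₀ H' hα hα3 hα4 hcB hα₄ hB h33 h69 hd hαP hαP3 hαP2 hBu hP hAx h129 hEbT hH0 hH1 hHequiv hQH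
    hCequiv hsmall hc₃ hsc hα₃' hs₁ hs₂ hs₃ hs₄ hs₅ hs₆ hs₇ hsm
  -- joint J-SU: `D′(u₁⁻¹, −iλ_s)` is `τ`-free for `τ`-free `λ_s` (the invariant closed set of `τ`-free families, `sectE_traceFree`)
  have hDpτ : ∀ s : lamSubK η U₀ L k Eb, ‖s‖ ≤ α₄ / 4 → (∀ x, τ (lamOf s x) = 0) → ∀ p, τ (Dp (lamOf s) p) = 0 :=
    fun s hs hsτ => sectE_traceFree τ hLs hs1 hη hU₀ H' hα hα3 hα4 hcB hα₄ hB h33 h69 hd hαP hαP3 hαP2 hBu hP hAx h129 hEbT hH0 hH1 hHτ hCτ hsmall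
      hc₃ hsc hα₃' hs₁ hs₂ hs₃ hs₄ hs₅ hs₆ hs₇ hsm s hs hsτ (hDp s hs).1 (hDp s hs).2.2.1 (hDp s hs).2.2.2.1
  have hcτ : ∀ s : lamSubK η U₀ L k Eb, ‖s‖ ≤ α₄ / 4 → (∀ x, τ (lamOf s x) = 0) →
      ∀ x, τ (((-I) • H' (Dp (lamOf s))) x) = 0 := fun s hs hsτ x => by
    rw [Pi.smul_apply, map_smul, hHτ _ (hDpτ s hs hsτ) x, smul_zero]
  -- sizes of D′ and of its differences, multiplied by the (1.92) constants
  have hbdX : ∀ s : lamSubK η U₀ L k Eb, ‖s‖ ≤ α₄ / 4 → B₀' * ‖Dp (lamOf s)‖ ≤ hE := fun s hs => by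
    rw [hE_def]; exact mul_le_mul_of_nonneg_left (hDp s hs).2.1 hB.le
  have hbdX₂ : ∀ s : lamSubK η U₀ L k Eb, ‖s‖ ≤ α₄ / 4 → B₂' * ‖Dp (lamOf s)‖ ≤ hE₂ := fun s hs => by
    rw [hE₂_def]; exact mul_le_mul_of_nonneg_left (hDp s hs).2.1 hB₂
  have hbdL : ∀ s t : lamSubK η U₀ L k Eb, ‖s‖ ≤ α₄ / 4 → ‖t‖ ≤ α₄ / 4 → B₀' * ‖Dp (lamOf s) - Dp (lamOf t)‖ ≤ lE * ‖s - t‖ :=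
    fun s t hs ht => by
    rw [lE_def, mul_assoc]; exact mul_le_mul_of_nonneg_left (hDpL s t hs ht) hB.le
  have hbdL₂ : ∀ s t : lamSubK η U₀ L k Eb, ‖s‖ ≤ α₄ / 4 → ‖t‖ ≤ α₄ / 4 → B₂' * ‖Dp (lamOf s) - Dp (lamOf t)‖ ≤ lE₂ * ‖s - t‖ :=
    fun s t hs ht => by
    rw [lE₂_def, mul_assoc]; exact mul_le_mul_of_nonneg_left (hDpL s t hs ht) hB₂
  have hsubH : ∀ s t : lamSubK η U₀ L k Eb, (-I) • H' (Dp (lamOf s)) - (-I) • H' (Dp (lamOf t)) = (-I) • H' (Dp (lamOf s) - Dp (lamOf t)) :=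
    fun s t => by rw [map_sub, smul_sub]
  -- the eight binders of JOIN-B for `H_c λ := −i·H′D′(u₁⁻¹, −iλ)`
  have hc0 : ∀ s : lamSubK η U₀ L k Eb, ‖s‖ ≤ α₄ / 4 → ∀ x, ‖((-I) • H' (Dp (lamOf s))) x‖ ≤ hE := fun s hs x => by
    rw [Pi.smul_apply, norm_negI_smul]; exact (hH0 _ x).trans (hbdX s hs)
  have hc1 : ∀ s : lamSubK η U₀ L k Eb, ‖s‖ ≤ α₄ / 4 → ∀ j, j ≤ k → ∀ p ∈ Eb j,
      wt L η j * ‖covDerivFwd η U₀ p.2 ((-I) • H' (Dp (lamOf s))) p.1‖ ≤ hE := fun s hs j hj p hp => by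
    rw [covDerivFwd_smul, norm_negI_smul]; exact (hH1 j hj _ p hp).trans (hbdX s hs)
  have hc2 : ∀ s : lamSubK η U₀ L k Eb, ‖s‖ ≤ α₄ / 4 → Bd2 L η k Ω (covLap η U₀ ((-I) • H' (Dp (lamOf s)))) hE₂ :=
    fun s hs j hj x hx => by
    rw [covLap_smul, norm_negI_smul]; exact (hH2 _ j hj x hx).trans (hbdX₂ s hs)
  have hcL0 : ∀ s t : lamSubK η U₀ L k Eb, ‖s‖ ≤ α₄ / 4 → ‖t‖ ≤ α₄ / 4 → ∀ x,
      ‖((-I) • H' (Dp (lamOf s))) x - ((-I) • H' (Dp (lamOf t))) x‖ ≤ lE * ‖s - t‖ := fun s t hs ht x => by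
    rw [← Pi.sub_apply, hsubH, Pi.smul_apply, norm_negI_smul]; exact (hH0 _ x).trans (hbdL s t hs ht)
  have hcL1 : ∀ s t : lamSubK η U₀ L k Eb, ‖s‖ ≤ α₄ / 4 → ‖t‖ ≤ α₄ / 4 → ∀ j, j ≤ k → ∀ p ∈ Eb j,
      wt L η j * ‖covDerivFwd η U₀ p.2 ((-I) • H' (Dp (lamOf s)) - (-I) • H' (Dp (lamOf t))) p.1‖ ≤ lE * ‖s - t‖ :=
    fun s t hs ht j hj p hp => by
    rw [hsubH, covDerivFwd_smul, norm_negI_smul]; exact (hH1 j hj _ p hp).trans (hbdL s t hs ht)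
  have hcL2 : ∀ s t : lamSubK η U₀ L k Eb, ‖s‖ ≤ α₄ / 4 → ‖t‖ ≤ α₄ / 4 →
      Bd2 L η k Ω (covLap η U₀ ((-I) • H' (Dp (lamOf s))) - covLap η U₀ ((-I) • H' (Dp (lamOf t)))) (lE₂ * ‖s - t‖) :=
    fun s t hs ht j hj x hx => by
    rw [Pi.sub_apply, ← covLap_sub, hsubH, covLap_smul, norm_negI_smul]; exact (hH2 _ j hj x hx).trans (hbdL₂ s t hs ht)
  have hcsa : ∀ s : lamSubK η U₀ L k Eb, ‖s‖ ≤ α₄ / 4 → (∀ x, IsSelfAdjoint (lamOf s x)) →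
      ∀ x, IsSelfAdjoint (((-I) • H' (Dp (lamOf s))) x) := fun s hs hsa x => by
    rw [Pi.smul_apply]
    refine isSelfAdjoint_negI_smul_of_skew ?_
    have hX : ∀ p, Dp (lamOf s) p = -star (Dp (lamOf s) p) := fun p => by rw [hDpR s hs hsa p, neg_neg]
    have h2 := congrArg star (hHequiv (Dp (lamOf s)) (Dp (lamOf s)) hX x)
    rw [star_neg, star_star] at h2
    exact h2
  have hcsupp : ∀ s : lamSubK η U₀ L k Eb, ‖s‖ ≤ α₄ / 4 → ∀ x, x ∉ Ω 0 → ((-I) • H' (Dp (lamOf s))) x = 0 := fun s _ x hx => by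
    rw [Pi.smul_apply, hHsupp _ x hx, smul_zero]
  -- «Q′(u₁⁻¹, e^{−iλ′}) = 0 on 𝔅_k» from (1.114), in the shape of the local route
  have h179E : ∀ s : lamSubK η U₀ L k Eb, ‖s‖ ≤ α₄ / 4 → q (lamOf s) = 0 →
      Cond179Z L k Λs U₀ (fun x => expUnit (((-I) • (lamOf s + (-I) • H' (Dp (lamOf s)))) x)) u₁⁻¹ := fun s hs hq0 =>
    cond179_of_eq114' H' q hq s (hDp s hs).2.2.2.2 hq0
  -- r04's Prop-10 windows at 8α₄ from the Sect. E windows at 2α₄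
  have hC6 : (0 : ℝ) ≤ C6 d := by
    have : (2 : ℝ) ≤ C6 d := by unfold C6; linarith only [one_le_C5 (d := d)]
    linarith only [this]
  have hw₁ : 10 * C6 d * (4 * (2 * α₄)) ≤ 1 := by nlinarith only [hs₁, hC6, hα₄.le]
  have hw₂ : 3000 * ((d : ℝ) + 1) * L * (4 * (2 * α₄)) ≤ 1 := by
    have e : 3000 * ((d : ℝ) + 1) * L * (4 * (2 * α₄)) = 12000 * ((d : ℝ) + 1) * L * (2 * α₄) := by ring
    rw [e]; exact hs₂
  exact hFP_kLevel_of179_local_RD_traceFree τ hτ (hlog_of_tracial τ hτ) hLs hs1 hη hd hU₀ hEbΩ hEbT g Δ q qs Aw c g_rightΩ c_range hΔ hqs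
    (fun lam => (-I) • H' (Dp lam)) hα hα3 hα4 hcB hαP hαP3 hαP2 hBu h33 h69 hP hAx h129 hsmall hc₃ hsc hα₃' hw₁ hw₂ hs₃ hs₄ hs₅ hs₆ hprod
    hα₄ hBG hBR hhE hhE₂ hlE hlE hlE₂ hcA hcA' hcDA ha₁' hb₁' hb₁ hθ hh₀' hh₀' hG hGsupp hGreal hRbd hRreal hc0 hc1 hc2 hcL0 hcL1 hcL2 hcsa
    hcsupp hDA hDAsa hA hAsa h103 h106 h179E hDAτ hcτ hRτ hGτ

/-- **JOIN-C, LOCAL ROUTE, [3]'S REMAINDER COVARIANCE DISCHARGED, INVERSE LAWS ON PRINT'S DOMAINS — WITH THE GAUGE PARAMETER `τ`-FREE** (joint J-SU):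
`B8Prop5JoinSectELocalRD.hFP_kLevel_of_sectE_local'_RD` VERBATIM — the theorem the `SockHFP` providers of `B8SockHFPRD` instantiate — plus the
`τ`-hypotheses of `hFP_kLevel_of_sectE_local_RD_traceFree` and the extra conclusion **`τ(λ′(x)) = 0`**.  (`hCequiv` is discharged by n04-b's
`Cnl_negStar_inv_of_axial` as in the original; `hCτ`, its `τ`-analogue, stays displayed.)
[cite: Balaban1985RegularSpaces, Prop. 5 (1.107)–(1.109) p.94, (1.113)–(1.121) pp.95–97, p.76; Balaban1985Averaging, (78)–(80) p.30, (178) p.45, Prop. 10 p.50, (213) p.50] -/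
theorem hFP_kLevel_of_sectE_local'_RD_traceFree (hτ : ∀ x y : 𝔸, τ (x * y) = τ (y * x)) (hLs : L = 2 * sL + 1) (hs1 : 1 ≤ sL) (hη : 0 < η) (hU₀ : ∀ x κ, U₀ x κ ∈ unitaryUnits 𝔸)
    (hEbΩ : ∀ j, j ≤ k → ∀ x ∈ Ω j, ∀ μ : Fin d, (x, μ) ∈ Eb j ∧ (x - e μ, μ) ∈ Eb j)
    (hEbT : ∀ j, j ≤ k → ∀ y ∈ Λs j, ∀ (x : Site d) (κ : Fin d), InBox (tlo L y j) (thi L y j) x →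
      InBox (tlo L y j) (thi L y j) (x + e κ) → (x, κ) ∈ Eb j)
    -- letters of [4]
    (g Δ : (Site d → 𝔸) →ₗ[ℂ] (Site d → 𝔸)) (q : (Site d → 𝔸) →ₗ[ℂ] (ℕ → Site d → 𝔸)) (qs : (ℕ → Site d → 𝔸) →ₗ[ℂ] (Site d → 𝔸))
    (Aw c : (ℕ → Site d → 𝔸) →ₗ[ℂ] (ℕ → Site d → 𝔸))
    (g_rightΩ : ∀ x, ∀ y ∈ Ω 0, (Δ (g x) + qs (Aw (q (g x)))) y = x y)
    (c_range : ∀ f, q (g (g (qs (c (q f))))) = q f)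
    (hΔ : ∀ (f : Site d → 𝔸), ∀ x ∈ Ω 0, Δ f x = covLap η U₀ ((Ω 0).indicator f) x)
    (hqs : ∀ (μ : ℕ → Site d → 𝔸), ∀ x ∈ Ω 0, qs μ x = QTZ L k Λs U₀ μ x)
    (hq : ∀ (f : Site d → 𝔸) (j : ℕ), j ≤ k → ∀ y ∈ Λs j, q f j y = QprimeIter (zdBlockingZ d L) (bgTZ L U₀) j f y)
    -- the letter H′ of [4] ((1.92)) and the Sect. E / local-inversion / covariance regime (tower-local, everything AT u₁)
    (H' : XSpace d k 𝔸 →ₗ[ℂ] (Site d → 𝔸)) {B : Site d → Fin d → 𝔸} {α₀ αP α₄ cB B₀' B₂' : ℝ}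
    (hα : 0 < α₀) (hα3 : C0Z d * α₀ ≤ 1 / 3) (hα4 : 4 * α₀ ≤ c2' d L) (hcB : 0 ≤ cB) (hα₄ : 0 < α₄) (hB : 0 < B₀') (hB₂ : 0 ≤ B₂')
    (h33 : ∀ j, j ≤ k → ∀ y ∈ Λs j, pdevOn (tlo L y j) (thi L y j) U₀ < α₀ * (((L : ℝ) ^ j)⁻¹) ^ 2)
    (h69 : ∀ j, j ≤ k → ∀ y ∈ Λs j, ∀ (x : Site d) (κ : Fin d), InBox (tlo L y j) (thi L y j) x →
      InBox (tlo L y j) (thi L y j) (x + e κ) → ‖B x κ‖ ≤ cB * ((L : ℝ) ^ j)⁻¹)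
    (hd : 1 ≤ d) (hαP : 0 < αP) (hαP3 : C0Z d * αP ≤ 1 / 3) (hαP2 : 2 * αP ≤ c2' d L)
    (hBu : ∀ (x : Site d) (κ : Fin d), expCfg B x κ ∈ unitaryUnits 𝔸)
    (hP : ∀ j, j ≤ k → ∀ y ∈ Λs j, pdevOn (tlo L y j) (thi L y j) (expCfg B * U₀) < αP * (((L : ℝ) ^ j)⁻¹) ^ 2)
    (hAx : InAxZ L k Λs U₀ (mgauge U₀ u₁ (expCfg B) * U₀)) (h129 : Restr129Z L k Λs U₀ u₁)
    (hH0 : ∀ (X : XSpace d k 𝔸) (x : Site d), ‖H' X x‖ ≤ B₀' * ‖X‖)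
    (hH1 : ∀ j, j ≤ k → ∀ (X : XSpace d k 𝔸), ∀ p ∈ Eb j, wt L η j * ‖covDerivFwd η U₀ p.2 (H' X) p.1‖ ≤ B₀' * ‖X‖)
    (hH2 : ∀ X : XSpace d k 𝔸, Bd2 L η k Ω (covLap η U₀ (H' X)) (B₂' * ‖X‖))
    (hHsupp : ∀ (X : XSpace d k 𝔸) (x : Site d), x ∉ Ω 0 → H' X x = 0)
    (hHequiv : ∀ X Y : XSpace d k 𝔸, (∀ p, Y p = -star (X p)) → ∀ x, H' Y x = -star (H' X x))
    (hQH : ∀ (Y : XSpace d k 𝔸) (j : ℕ) (hj : j ≤ k) (y : Site d), y ∈ Λs j →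
      QprimeIter (zdBlockingZ d L) (bgTZ L U₀) j (H' Y) y = Y (⟨j, Nat.lt_succ_of_le hj⟩, y))
    (hsmall : Real.exp (4 * cZ d * α₀) * (1 + 2 * (131072 * ((d : ℝ) + 1) ^ 2) * (KZ d L) ^ 2 * cB) ≤ 2)
    (hc₃ : KZ d L * cB ≤ c3 d L) (hsc : 1024 * (d : ℝ) * KZ d L * cB ≤ 1) (hα₃' : 20 * d * KZ d L * cB ≤ 1 / 200)
    (hs₁ : 200 * C6 d * (2 * α₄) ≤ 1) (hs₂ : 12000 * ((d : ℝ) + 1) * L * (2 * α₄) ≤ 1)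
    (hs₃ : C4G d L * (α₀ + 20 * d * KZ d L * cB + 4 * (2 * α₄)) ≤ 1)
    (hs₄ : 1024 * ((d : ℝ) + 1) * ((d : ℝ) + 4) * L ^ 2 * α₀ ≤ 1) (hs₅ : 32 * ((d : ℝ) + 1) ^ 2 * C6 d * L ^ 2 * α₀ ≤ 1)
    (hs₆ : 16 * d * C5' d * C6 d * (L : ℝ) ^ 2 * α₀ ≤ 1) (hs₇ : 8 * d * C6 d * L * α₀ ≤ 1)
    (hsm : 20 * d * KZ d L * cB + α₄ ≤ 1 / (4 * B₀' * (2 * C2p d))) (hprod8 : 2 * C6 d * (20 * d * KZ d L * cB + 4 * α₄) ≤ 1 / 8)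
    -- the Sect. E sizes of H_c (named, so that the windows below read)
    {hE hE₂ lE lE₂ : ℝ} (hE_def : hE = B₀' * (C2p d * (20 * d * KZ d L * cB + α₄) * α₄)) (hE₂_def : hE₂ = B₂' * (C2p d * (20 * d * KZ d L * cB + α₄) * α₄))
    (lE_def : lE = B₀' * (4 * C2p d * (20 * d * KZ d L * cB + 2 * α₄))) (lE₂_def : lE₂ = B₂' * (4 * C2p d * (20 * d * KZ d L * cB + 2 * α₄)))
    -- JOIN-B's letters G′, R, the datum, and its windows at these sizes
    {BG BR cA cDA : ℝ} (hBG : 0 ≤ BG) (hBR : 0 ≤ BR) (hcA : 0 ≤ cA) (hcA' : cA ≤ 1 / 13) (hcDA : 0 ≤ cDA)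
    (ha₁' : α₄ / 4 + hE ≤ 1 / 24) (hb₁' : α₄ / 4 + hE ≤ 1 / 140) (hθ : 10 * (α₄ / 4 + hE) * BR ≤ 1 / 2)
    (hG : ∀ (f : Site d → 𝔸) (m : ℝ), 0 ≤ m → Bd2 L η k Ω f m →
      (∀ x, ‖g f x‖ ≤ BG * m) ∧ ∀ j, j ≤ k → ∀ p ∈ Eb j, wt L η j * ‖covDerivFwd η U₀ p.2 (g f) p.1‖ ≤ BG * m)
    (hGsupp : ∀ (f : Site d → 𝔸) (x : Site d), x ∉ Ω 0 → g f x = 0)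
    (hGreal : ∀ f : Site d → 𝔸, (∀ j, j ≤ k → ∀ x ∈ Ω j, IsSelfAdjoint (f x)) → ∀ x, IsSelfAdjoint (g f x))
    (hRbd : ∀ (f : Site d → 𝔸) (m : ℝ), 0 ≤ m → Bd2 L η k Ω f m → Bd2 L η k Ω (f - g (qs (c (q (g f))))) (BR * m))
    (hRreal : ∀ f : Site d → 𝔸, (∀ j, j ≤ k → ∀ x ∈ Ω j, IsSelfAdjoint (f x)) →
      ∀ j, j ≤ k → ∀ x ∈ Ω j, IsSelfAdjoint ((f - g (qs (c (q (g f))))) x))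
    (hDA : Bd2 L η k Ω (fun y => covDivB η U₀ A y) cDA) (hDAsa : ∀ j, j ≤ k → ∀ x ∈ Ω j, IsSelfAdjoint (covDivB η U₀ A x))
    (hA : ∀ j, j ≤ k → ∀ x ∈ Ω j, ∀ μ : Fin d,
      wt L η j * ‖A x μ‖ ≤ cA ∧ wt L η j * ‖conjR (U₀ (x - e μ) μ)⁻¹ (A (x - e μ) μ)‖ ≤ cA)
    (hAsa : ∀ x μ, IsSelfAdjoint (A x μ))
    (h103 : BG * Mc d BR (α₄ / 4 + hE) cA hE₂ cDA ≤ α₄ / 4)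
    (h106 : BG * Kc d BR (α₄ / 4 + hE) cA hE₂ cDA lE₂ (1 + lE) (1 + lE) ≤ 1 / 2)
    -- `τ`-freeness of the datum and `τ`-compatibility of the letters (joint J-SU)
    (hDAτ : ∀ j, j ≤ k → ∀ x ∈ Ω j, τ (covDivB η U₀ A x) = 0)
    (hHτ : ∀ X : XSpace d k 𝔸, (∀ p, τ (X p) = 0) → ∀ x, τ (H' X x) = 0)
    (hCτ : ∀ j, j ≤ k → ∀ y ∈ Λs j, ∀ μ : Site d → 𝔸, (∀ x, τ (μ x) = 0) →
      (∀ x : Site d, InBox (tlo L y j) (thi L y j) x → ‖μ x‖ < α₄) →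
      (∀ (x : Site d) (κ : Fin d), InBox (tlo L y j) (thi L y j) x → InBox (tlo L y j) (thi L y j) (x + e κ) →
        ‖cj (U₀ x κ) (μ (x + e κ)) - μ x‖ < α₄ * ((L : ℝ) ^ j)⁻¹) →
      τ (CnlZ L U₀ u₁⁻¹ j μ y) = 0)
    (hRτ : ∀ f : Site d → 𝔸, (∀ j, j ≤ k → ∀ x ∈ Ω j, τ (f x) = 0) →
      ∀ j, j ≤ k → ∀ x ∈ Ω j, τ ((f - g (qs (c (q (g f))))) x) = 0)
    (hGτ : ∀ f : Site d → 𝔸, (∀ j, j ≤ k → ∀ x ∈ Ω j, τ (f x) = 0) → ∀ x, τ (g f x) = 0) :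
    ∃ lam : Site d → 𝔸, (∀ x, IsSelfAdjoint (lam x)) ∧ (∀ x, x ∉ Ω 0 → lam x = 0) ∧ (∀ x, τ (lam x) = 0) ∧
      (∀ j, j ≤ k → ∀ p ∈ Eb j, ‖lam p.1‖ ≤ α₄ ∧ wt L η j * ‖covDerivFwd η U₀ p.2 lam p.1‖ ≤ α₄) ∧
      (∃ μ : ℕ → Site d → 𝔸, ∀ x ∈ Ω 0,
        covLap η U₀ ((Ω 0).indicator fun y => covDivB η U₀ A y + covLap η U₀ lam y +
          ((conjR (gaugeExp lam y)⁻¹ (covDivB η U₀ A y) - covDivB η U₀ A y) +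
            (gAd (covLap η U₀ lam y) (lam y) - covLap η U₀ lam y) + ∑ μ, frakF3 η U₀ lam A y μ)) x = QTZ L k Λs U₀ μ x) ∧
      Restr129Z L k Λs U₀ (u₁ * gaugeExp lam) := by
  have hC6 : (0 : ℝ) ≤ C6 d := by
    have : (2 : ℝ) ≤ C6 d := by unfold C6; linarith only [one_le_C5 (d := d)]
    linarith only [this]
  have hα₃ : (0 : ℝ) ≤ 20 * d * KZ d L * cB := alpha3Z_nonneg L hcB
  have hC4G : 0 ≤ C4G d L := by
    have h7 : (0 : ℝ) ≤ B7Prop10General.C7 d := by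
      unfold B7Prop10General.C7 C6; linarith only [one_le_C5 (d := d), C5'_nonneg (d := d)]
    have h4' := C4'_nonneg (d := d)
    unfold C4G; positivity
  -- the local route's product window and (D)'s windows at 4α₄ from the Sect. E windows at 2α₄ and `hprod8`
  have hprod : 2 * C6 d * (20 * d * KZ d L * cB + 4 * (2 * α₄)) < 1 / 2 := by nlinarith only [hprod8, hC6, hα₃, hα₄.le]
  have h204w : C6 d * (4 * α₄) ≤ 1 / 8 := by nlinarith only [hprod8, hC6, hα₃, hα₄.le]
  have hd₁ : 10 * C6 d * (4 * α₄) ≤ 1 := by nlinarith only [hs₁, hC6, hα₄.le]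
  have hd₂ : 3000 * ((d : ℝ) + 1) * L * (4 * α₄) ≤ 1 := by
    have e : 3000 * ((d : ℝ) + 1) * L * (4 * α₄) = 12000 * ((d : ℝ) + 1) * L * (2 * α₄) / 2 := by ring
    rw [e]; linarith only [hs₂, show (0:ℝ) ≤ 12000 * ((d : ℝ) + 1) * L * (2 * α₄) by positivity]
  have hd₃ : C4G d L * (α₀ + 20 * d * KZ d L * cB + 4 * α₄) ≤ 1 :=
    (mul_le_mul_of_nonneg_left (by linarith only [hα₄]) hC4G).trans hs₃
  have hCequiv := Cnl_negStar_inv_of_axial Λs hLs hs1 hd (by omega) hU₀ hα hα3 hα4 hcB hα₄ hαP hαP3 hαP2 hBu h33 h69 hP hAx h129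
    hsmall hc₃ hsc (by linarith only [hα₃']) hd₁ hd₂ hd₃ hs₄ hs₅ hs₆ hprod8 h204w
  exact hFP_kLevel_of_sectE_local_RD_traceFree τ hτ hLs hs1 hη hU₀ hEbΩ hEbT g Δ q qs Aw c g_rightΩ c_range hΔ hqs hq H' hα hα3 hα4 hcB hα₄
    hB hB₂ h33 h69 hd hαP hαP3 hαP2 hBu hP hAx h129 hH0 hH1 hH2 hHsupp hHequiv hQH hCequiv hsmall hc₃ hsc hα₃' hs₁ hs₂ hs₃ hs₄ hs₅ hs₆ hs₇
    hsm hprod hE_def hE₂_def lE_def lE₂_def hBG hBR hcA hcA' hcDA ha₁' hb₁' hθ hG hGsupp hGreal hRbd hRreal hDA hDAsa hA hAsa h103 h106 hDAτ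
    hHτ hCτ hRτ hGτ

end JoinLocal

#print axioms hFP_kLevel_of_sectE_local'_RD_traceFree

end Literature.MathematicalPhysics.QuantumFieldTheory.Balaban1983to89.B8SectETraceFreeRec

end
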